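import Mathlib
import HarnessLib
import Literature.Analysis.FluidPDE.TaoEnstrophyLocalisation
import Summits.NavierStokesRegularity.NavierStokesRegularity.Theorems.PoloidalWindowDoorPoloidalWindowRigidityWindow
import Summits.NavierStokesRegularity.NavierStokesRegularity.Theorems.PoloidalWindowDoorPoloidalWindowRigidityLeafUniformVortexLine
import Summits.NavierStokesRegularity.NavierStokesRegularity.Theorems.PoloidalWindowDoorPoloidalWindowRigidityLeafUniformRidgeCore
import Summits.NavierStokesRegularity.NavierStokesRegularity.Theorems.PoloidalWindowDoorPoloidalWindowRigidityLeafUniformRidgeInvariant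
import Summits.NavierStokesRegularity.NavierStokesRegularity.Theorems.PoloidalWindowDoorPoloidalWindowRigidityLeafUniformCurtainCore

/-!
# Route `PoloidalWindowDoor`, crux `PoloidalWindowRigidity` (stmt-NavierStokesRegularity-19708) — LINE 18 «leaf_uniform»
# (ns-idea-8 g9, v1.3.1; critic idea-crit-7 g6 PASS): the LOAD-BEARING curtain invariant R11 `CurtainInvariant`,
# VERBATIM (Cruxes-local `Pinned` / `IsHotArc` / `hotSet` / `lapH` / `hess` / `curtain` unfolded)

Seat ns-es-p1 g7 (free prover hand; R11 was «L, unowned» in KEY-NS #190 / the 05:21Z census of ns-poloidal-K2-p2 g13; CLAIM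
announced on the ideators / ns-regularity-ideate buses before proposing).

* `curtainInvariant` (R11 `CurtainInvariant`): on a hot vortex arc `γ : (−ε, ε) → H` of a pinned class profile with the frozen
  law that is MORSE at its base point (`Δₕv₂(γ 0) ≠ 0`), the curtain quantity `I₂ = ∂₂₂v₂ − |∇ₕ∂₂v₂|²/Δₕv₂` is constant:
  `curtain(γ τ) = curtain(γ 0)` for `τ ∈ (−ε, ε)`.

PROOF — NOT the card's implicit-function route (ridge surface `S = {∂ₙ̂w = 0}`), but a direct transport identity: along the arc
`∇w = 0` (hot points are global extrema of `w = v₂(−1,·)`), so differentiating the frozen law `ω₀∂₀w + ω₁∂₁w ≡ 0` twice gives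
the derivative of every `∂ₐ∂ᵦw ∘ γ` in terms of first derivatives of `ω` and second derivatives of `w`
(`…LeafUniformCurtainCore.transport_hasDerivAt`); the kernel relations `Hₕωₕ = 0`, `u := ∇ₕ∂₂w ⊥ ωₕ` with `ωₕ ≠ 0` force
`Hₕu = Δₕw·u` and `|u|²Hₕ = Δₕw·u⊗u`, and the transported derivatives of `∂₂₂w`, `|u|²`, `Δₕw` cancel in `(I₂ ∘ γ)′`
(`…LeafUniformCurtainCore.curtain_core`).  `Δₕw ≠ 0` along the arc comes from this seat's R8 (`…RidgeInvariant.ridgeInvariant`,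
ratio law) and `ω ≠ 0` along the arc (ODE uniqueness with ns-poloidal-K2-p2 g13's `curl_slice_bounded_lipschitz`, imported by
name); `IsOpen.is_const_of_deriv_eq_zero` on `(−ε, ε)` closes.

HONEST LABEL: ONE structure stub (L) of a registered line; it closes no cell, no crux and no route item; the research cells, C2a′ /
C2b′ / S0, 19708 / 20428 and NS regularity stay OPEN — no summit statement is proved here.
-/

noncomputable section

-- the summit and its single sub-problem share the name (CONVENTIONS §1), as in every Theorems file
set_option linter.dupNamespace false

namespace Summit.NavierStokesRegularity.NavierStokesRegularity.Theorems.PoloidalWindowDoorPoloidalWindowRigidityLeafUniformCurtainInvariant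

open Set Function Filter Topology Metric
open scoped InnerProductSpace RealInnerProductSpace Laplacian NNReal
open Literature.Analysis Literature.Analysis.FluidPDE
open Summit.NavierStokesRegularity.NavierStokesRegularity.Theorems.PoloidalWindowDoorPoloidalWindowRigidityWindow
open Summit.NavierStokesRegularity.NavierStokesRegularity.Theorems.PoloidalWindowDoorPoloidalWindowRigidityLeafUniformVortexLine
open Summit.NavierStokesRegularity.NavierStokesRegularity.Theorems.PoloidalWindowDoorPoloidalWindowRigidityLeafUniformRidgeCore
open Summit.NavierStokesRegularity.NavierStokesRegularity.Theorems.PoloidalWindowDoorPoloidalWindowRigidityLeafUniformRidgeInvariant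
open Summit.NavierStokesRegularity.NavierStokesRegularity.Theorems.PoloidalWindowDoorPoloidalWindowRigidityLeafUniformCurtainCore

/-! ## R11 — the curtain invariant along a Morse hot vortex arc -/

/-- **R11 `CurtainInvariant` (VERBATIM, `Pinned` / `IsHotArc` / `hotSet` / `lapH` / `hess` / `curtain` unfolded).**  See the
module docstring. -/
theorem curtainInvariant :
    ∀ (C : ℝ) (v : ℝ → EuclideanSpace ℝ (Fin 3) → EuclideanSpace ℝ (Fin 3)),
      (Literature.Analysis.FluidPDE.HasTypeITimeDecay C v ∧
        ContinuousOn (Function.uncurry v) (Set.Iio (0 : ℝ) ×ˢ Set.univ) ∧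
        (∀ s t : ℝ, s < t → t < 0 → ∀ x, v t x =
          Literature.Analysis.UnboundedOperators.heatExtension (v s) (t - s) x -
            Literature.Analysis.FluidPDE.oseenDuhamel 1 s v v t x) ∧
        (∀ t < 0, Literature.Analysis.FluidPDE.VectorCalculus.IsDivFree (v t)) ∧
        (∀ s < 0, ∀ y, ⟪Literature.Analysis.FluidPDE.curl (v s) y, EuclideanSpace.single 2 1⟫_ℝ = 0) ∧
        v (-1) 0 2 ≠ 0 ∧ (∀ t < 0, ∀ x, Real.sqrt (-t) * |v t x 2| ≤ |v (-1) 0 2|) ∧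
        (∀ h : EuclideanSpace ℝ (Fin 3), fderiv ℝ (v (-1)) 0 h 2 = 0) ∧
        (deriv (fun s => v s 0 2) (-1) = v (-1) 0 2 / 2 ∧ v (-1) 0 2 * (Δ (fun y => v (-1) y 2)) 0 ≤ 0)) →
      (∀ s < 0, ∀ y, ⟪fderiv ℝ (v s) y (Literature.Analysis.FluidPDE.curl (v s) y), EuclideanSpace.single 2 1⟫_ℝ = 0) →
      ∀ (γ : ℝ → EuclideanSpace ℝ (Fin 3)) (ε : ℝ),
        (0 < ε ∧ γ 0 ∈ {y : EuclideanSpace ℝ (Fin 3) | y 2 = 0 ∧ v (-1) y 2 = v (-1) 0 2} ∧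
            Literature.Analysis.FluidPDE.curl (v (-1)) (γ 0) ≠ 0 ∧
            ∀ τ ∈ Set.Ioo (-ε) ε, HasDerivAt γ (Literature.Analysis.FluidPDE.curl (v (-1)) (γ τ)) τ ∧
              γ τ ∈ {y : EuclideanSpace ℝ (Fin 3) | y 2 = 0 ∧ v (-1) y 2 = v (-1) 0 2}) →
        (fderiv ℝ (fun x => fderiv ℝ (fun x' => v (-1) x' 2) x (EuclideanSpace.single 0 1)) (γ 0) (EuclideanSpace.single 0 1) +
              fderiv ℝ (fun x => fderiv ℝ (fun x' => v (-1) x' 2) x (EuclideanSpace.single 1 1)) (γ 0) (EuclideanSpace.single 1 1)) ≠ 0 →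
        ∀ τ ∈ Set.Ioo (-ε) ε,
          (fderiv ℝ (fun x => fderiv ℝ (fun x' => v (-1) x' 2) x (EuclideanSpace.single 2 1)) (γ τ) (EuclideanSpace.single 2 1) -
            (fderiv ℝ (fun x => fderiv ℝ (fun x' => v (-1) x' 2) x (EuclideanSpace.single 2 1)) (γ τ) (EuclideanSpace.single 0 1) ^ 2 +
                fderiv ℝ (fun x => fderiv ℝ (fun x' => v (-1) x' 2) x (EuclideanSpace.single 2 1)) (γ τ) (EuclideanSpace.single 1 1) ^ 2) /
              (fderiv ℝ (fun x => fderiv ℝ (fun x' => v (-1) x' 2) x (EuclideanSpace.single 0 1)) (γ τ) (EuclideanSpace.single 0 1) +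
              fderiv ℝ (fun x => fderiv ℝ (fun x' => v (-1) x' 2) x (EuclideanSpace.single 1 1)) (γ τ) (EuclideanSpace.single 1 1))) =
          (fderiv ℝ (fun x => fderiv ℝ (fun x' => v (-1) x' 2) x (EuclideanSpace.single 2 1)) (γ 0) (EuclideanSpace.single 2 1) -
            (fderiv ℝ (fun x => fderiv ℝ (fun x' => v (-1) x' 2) x (EuclideanSpace.single 2 1)) (γ 0) (EuclideanSpace.single 0 1) ^ 2 +
                fderiv ℝ (fun x => fderiv ℝ (fun x' => v (-1) x' 2) x (EuclideanSpace.single 2 1)) (γ 0) (EuclideanSpace.single 1 1) ^ 2) /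
              (fderiv ℝ (fun x => fderiv ℝ (fun x' => v (-1) x' 2) x (EuclideanSpace.single 0 1)) (γ 0) (EuclideanSpace.single 0 1) +
              fderiv ℝ (fun x => fderiv ℝ (fun x' => v (-1) x' 2) x (EuclideanSpace.single 1 1)) (γ 0) (EuclideanSpace.single 1 1))) := by
  intro C v hP hfrozen γ ε harc hL0 τ hτ
  have hP' := hP
  obtain ⟨hTI, hcont, hmild, hdiv, hpol, -, hbound, -, -⟩ := hP'
  obtain ⟨hε, hγ0, hω0, harc'⟩ := harc
  have h0 : (0 : ℝ) ∈ Ioo (-ε) ε := ⟨by linarith, hε⟩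
  -- smoothness of the slice, of `w = v₂(−1,·)` and of `ω = curl v(−1,·)`
  have hclass : IsTypeIAncientMild C v := isTypeIAncientMild_of_class hTI hcont hmild hdiv
  have hvinf : ContDiff ℝ ((⊤ : ℕ∞) : WithTop ℕ∞) (v (-1)) := hclass.contDiff_slice (by norm_num)
  have hsm : ∀ n : ℕ, ContDiff ℝ n (v (-1)) := fun n => contDiff_infty.1 hvinf n
  have hvd : ∀ x, DifferentiableAt ℝ (v (-1)) x := fun x => ((hsm 1).differentiable one_ne_zero) x
  have hw : ∀ n : ℕ, ContDiff ℝ n (fun x' => v (-1) x' 2) := fun n => contDiff_euclidean.1 (hsm n) 2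
  have hωinf : ContDiff ℝ ((⊤ : ℕ∞) : WithTop ℕ∞) (curl (v (-1))) := by
    rw [curl_eq_curlCLM_comp]
    exact curlCLM.contDiff.comp (contDiff_infty_iff_fderiv.1 hvinf).2
  have hωs : ∀ n : ℕ, ContDiff ℝ n (curl (v (-1))) := fun n => contDiff_infty.1 hωinf n
  have hPs : ∀ (j : Fin 3) (n : ℕ), ContDiff ℝ n
      ((fun j : Fin 3 => fun x => fderiv ℝ (fun x' => v (-1) x' 2) x (EuclideanSpace.single j 1)) j) :=
    fun j n => contDiff_fderiv_apply_dir (n := n) (by exact_mod_cast hw (n + 1)) _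
  -- `ω₂ ≡ 0` (poloidal) and the frozen law in coordinates
  have hω2 : ∀ x, curl (v (-1)) x 2 = 0 := fun x => by
    have h := hpol (-1) (by norm_num) x
    rw [EuclideanSpace.inner_single_right] at h
    simpa using h
  have hFro : ∀ x, curl (v (-1)) x 0 * fderiv ℝ (fun x' => v (-1) x' 2) x (EuclideanSpace.single 0 1) +
      curl (v (-1)) x 1 * fderiv ℝ (fun x' => v (-1) x' 2) x (EuclideanSpace.single 1 1) = 0 := fun x => by
    have h := hfrozen (-1) (by norm_num) x
    rw [EuclideanSpace.inner_single_right] at h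
    have h' : fderiv ℝ (v (-1)) x (curl (v (-1)) x) 2 = 0 := by simpa using h
    rw [fderiv_apply_coord (hvd x), clm_apply_eq_sum_three, hω2 x, zero_mul, add_zero] at h'
    exact h'
  -- `∇w = 0` on the arc (global extremum of `w` by the pinned bound at `t = −1`)
  have hN1 : ∀ x, |v (-1) x 2| ≤ |v (-1) 0 2| := fun x => by
    have h := hbound (-1) (by norm_num) x
    rwa [neg_neg, Real.sqrt_one, one_mul] at h
  have hcrit : ∀ t ∈ Ioo (-ε) ε, fderiv ℝ (fun x' => v (-1) x' 2) (γ t) = 0 := by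
    intro t ht
    obtain ⟨-, hval⟩ : γ t 2 = 0 ∧ v (-1) (γ t) 2 = v (-1) 0 2 := (harc' t ht).2
    rcases le_or_gt 0 (v (-1) 0 2) with hN | hN
    · have hmax : IsLocalMax (fun x' => v (-1) x' 2) (γ t) :=
        Filter.Eventually.of_forall fun x => by
          show v (-1) x 2 ≤ v (-1) (γ t) 2
          rw [hval]
          exact (le_abs_self _).trans ((hN1 x).trans (abs_of_nonneg hN).le)
      exact hmax.fderiv_eq_zero
    · have hmin : IsLocalMin (fun x' => v (-1) x' 2) (γ t) :=
        Filter.Eventually.of_forall fun x => by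
          show v (-1) (γ t) 2 ≤ v (-1) x 2
          rw [hval]
          have h1 := hN1 x
          rw [abs_of_neg hN] at h1
          linarith [neg_abs_le (v (-1) x 2)]
      exact hmin.fderiv_eq_zero
  have hzero : ∀ (j : Fin 3), ∀ s ∈ Ioo (-ε) ε,
      ((fun j : Fin 3 => fun x => fderiv ℝ (fun x' => v (-1) x' 2) x (EuclideanSpace.single j 1)) j) (γ s) = 0 := by
    intro j s hs
    show fderiv ℝ (fun x' => v (-1) x' 2) (γ s) (EuclideanSpace.single j 1) = 0
    rw [hcrit s hs]
    rfl
  -- `ω ≠ 0` along the arc (ODE uniqueness against the constant solution; globally Lipschitz vorticity)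
  have hne : ∀ t ∈ Ioo (-ε) ε, curl (v (-1)) (γ t) ≠ 0 := by
    intro t ht hzero'
    obtain ⟨K, L, hK, -⟩ := curl_slice_bounded_lipschitz hTI hcont hmild hdiv (s := -1) (by norm_num)
    have huniq := ODE_solution_unique_of_mem_Ioo (v := fun _ => curl (v (-1))) (s := fun _ => (univ : Set _))
      (K := K) (f := γ) (g := fun _ => γ t) (t₀ := t) (fun _ _ => hK.lipschitzOnWith) ht
      (fun s hs => ⟨(harc' s hs).1, mem_univ _⟩)
      (fun s _ => ⟨by rw [hzero']; exact hasDerivAt_const s (γ t), mem_univ _⟩) rfl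
    exact hω0 (by rw [huniq h0]; exact hzero')
  -- `Δₕw ≠ 0` along the arc: R8's ratio law
  have hLne : ∀ s ∈ Ioo (-ε) ε, (fderiv ℝ (fun x => fderiv ℝ (fun x' => v (-1) x' 2) x (EuclideanSpace.single 0 1)) (γ s) (EuclideanSpace.single 0 1) +
              fderiv ℝ (fun x => fderiv ℝ (fun x' => v (-1) x' 2) x (EuclideanSpace.single 1 1)) (γ s) (EuclideanSpace.single 1 1)) ≠ 0 := by
    intro s hs hzero'
    have h := ridgeInvariant C v hP hfrozen γ ε ⟨hε, hγ0, hω0, harc'⟩ s hs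
    rw [hzero', zero_mul] at h
    exact mul_ne_zero hL0 (pow_ne_zero 2 (norm_ne_zero_iff.2 (hne s hs))) h.symm
  -- the transport identity: zero derivative of the curtain quantity at every point of the arc
  have hSch : ∀ (i j : Fin 3) (x : EuclideanSpace ℝ (Fin 3)),
      fderiv ℝ ((fun j : Fin 3 => fun x => fderiv ℝ (fun x' => v (-1) x' 2) x (EuclideanSpace.single j 1)) j) x
          (EuclideanSpace.single i 1) =
        fderiv ℝ ((fun j : Fin 3 => fun x => fderiv ℝ (fun x' => v (-1) x' 2) x (EuclideanSpace.single j 1)) i) x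
          (EuclideanSpace.single j 1) :=
    fun i j x => fderiv_dir_comm (hw 2).contDiffAt _ _
  have hd : ∀ s ∈ Ioo (-ε) ε, HasDerivAt (fun s =>
      (fderiv ℝ (fun x => fderiv ℝ (fun x' => v (-1) x' 2) x (EuclideanSpace.single 2 1)) (γ s) (EuclideanSpace.single 2 1) -
            (fderiv ℝ (fun x => fderiv ℝ (fun x' => v (-1) x' 2) x (EuclideanSpace.single 2 1)) (γ s) (EuclideanSpace.single 0 1) ^ 2 +
                fderiv ℝ (fun x => fderiv ℝ (fun x' => v (-1) x' 2) x (EuclideanSpace.single 2 1)) (γ s) (EuclideanSpace.single 1 1) ^ 2) /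
              (fderiv ℝ (fun x => fderiv ℝ (fun x' => v (-1) x' 2) x (EuclideanSpace.single 0 1)) (γ s) (EuclideanSpace.single 0 1) +
              fderiv ℝ (fun x => fderiv ℝ (fun x' => v (-1) x' 2) x (EuclideanSpace.single 1 1)) (γ s) (EuclideanSpace.single 1 1)))) 0 s := by
    intro s hs
    exact curtain_core (P := fun j : Fin 3 => fun x => fderiv ℝ (fun x' => v (-1) x' 2) x (EuclideanSpace.single j 1))
      hPs hωs hSch hFro hω2 hzero (fun r hr => (harc' r hr).1) hs (hLne s hs) (hne s hs)
  exact IsOpen.is_const_of_deriv_eq_zero (𝕜 := ℝ) isOpen_Ioo isPreconnected_Ioo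
    (fun s hs => (hd s hs).differentiableAt.differentiableWithinAt) (fun s hs => (hd s hs).deriv) hτ h0

end Summit.NavierStokesRegularity.NavierStokesRegularity.Theorems.PoloidalWindowDoorPoloidalWindowRigidityLeafUniformCurtainInvariant

end
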